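import Literature.Barriers.NavierStokesRegularity.SmallDataGlobalRegularity
import Literature.Analysis.FunctionSpaces.FourierSobolevNormEmbeddingProofs
import Literature.Analysis.FunctionSpaces.Complexify
import HarnessLib

/-!
# Small `Ḣ^{1/2}` data are globally regular — the Fujita–Kato threshold with a Clay (A) conclusion

Barrier catalogue support for `NavierStokesRegularity` (D-0021), sequel of
`Literature.Barriers.NavierStokesRegularity.SmallDataGlobalRegularity` (same method, everything PROVED):
the small-data theorem in the critical SOBOLEV norm. For a Clay datum `u₀` (smooth, divergence-free, rapidly
decaying on `ℝ³`) whose complexification has homogeneous Sobolev seminorm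
`‖u₀‖_{Ḣ^{1/2}} = (∫ |ξ| |û₀(ξ)|² dξ)^{1/2} ≤ δν`, the unforced Cauchy problem at viscosity `ν` has a smooth
bounded-energy solution on `ℝ³ × [0,∞)` — Fefferman's (A) conclusion for that datum
(`exists_clayA_of_small_homSobolevHalf`). Printed form: Lemarié-Rieusset 2016, Thm. 7.4 (B)
(«if `‖u₀‖_{Ḣ^{1/2}} < ε₀ν` … the mild solution is defined on `(0,+∞)`»), going back to Fujita–Kato 1964;
the kernel route is the tree's Kato small-`L³` Clay theorem (`exists_clayA_of_small_L3`, Kato 1984 Thm. 2/4)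
composed with the critical embedding `Ḣ^{1/2}(ℝ³) ⊂ L³(ℝ³)`
(`Literature.Analysis.FunctionSpaces.eLpNorm_three_le_eHomSobolevSeminorm_half_holds`, Bahouri–Chemin–Danchin
2011 Thm. 1.38), so the constant is `δ = δ_Kato/(C_emb + 1)`.

Use in cell `ns-claims` (D-0090): rows whose «small data» step is phrased through a weighted `L²` norm of
the Fourier transform (C35 `VasquezCampos2024`, `‖max{1,|ξ|}² û⁰‖_{L¹⊕L²}`) reduce to this lemma, since any
weight `≥ |ξ|^{1/2}` dominates the `Ḣ^{1/2}` seminorm.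

WHAT THIS IS NOT: not a claim about NS regularity or blow-up; not a claim about any author beyond the typed
locator.
-/

noncomputable section

open MeasureTheory Set Function Filter
open scoped ENNReal NNReal ContDiff Topology SchwartzMap

namespace Literature.Barriers.NavierStokesRegularity

open Literature.Analysis Literature.Analysis.FluidPDE Literature.Analysis.FunctionSpaces
open Literature.Analysis.FunctionSpaces.EuclideanSpace (complexify norm_complexify contDiff_complexify_comp_iff)

/-- The complexification of a Clay datum is a Schwartz map, hence in `L²(ℝ³; ℂ³)`. [folklore] -/
private theorem memLp_two_complexify_of_hasRapidSpatialDecay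
    {u₀ : EuclideanSpace ℝ (Fin 3) → EuclideanSpace ℝ (Fin 3)} (hsm : ContDiff ℝ ∞ u₀)
    (hdec : HasRapidSpatialDecay u₀) : MemLp (complexify ∘ u₀) 2 (volume : Measure (EuclideanSpace ℝ (Fin 3))) := by
  have hdecay : ∀ k n : ℕ, ∃ C : ℝ, ∀ x : EuclideanSpace ℝ (Fin 3),
      ‖x‖ ^ k * ‖iteratedFDeriv ℝ n (complexify ∘ u₀) x‖ ≤ C := by
    intro k n
    obtain ⟨C, hC⟩ := hdec n k
    refine ⟨C, fun x => le_trans ?_ (hC x)⟩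
    rw [(complexify (ι := Fin 3)).norm_iteratedFDeriv_comp_left hsm.contDiffAt (mod_cast le_top)]
    exact mul_le_mul_of_nonneg_right
      (pow_le_pow_left₀ (norm_nonneg _) (le_add_of_nonneg_left zero_le_one) k) (norm_nonneg _)
  exact (⟨complexify ∘ u₀, contDiff_complexify_comp_iff.2 hsm, hdecay⟩ :
    𝓢(EuclideanSpace ℝ (Fin 3), EuclideanSpace ℂ (Fin 3))).memLp 2 volume

/-- **Small `Ḣ^{1/2}` Clay data are globally regular (Clay (A) conclusion, datum-wise).** There is an
absolute `δ > 0` such that for every `ν > 0` and every smooth, divergence-free, rapidly decaying `u₀` on `ℝ³`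
with `‖u₀‖_{Ḣ^{1/2}} ≤ δν` (the seminorm `(∫ |ξ| |𝓕u₀(ξ)|² dξ)^{1/2}` of the complexified datum, the tree's
`Function.eHomSobolevSeminorm (1/2)`), the unforced Navier–Stokes system has a smooth solution `(u, p)` on
`ℝ³ × [0,∞)` with `u(·,0) = u₀` and bounded energy. Kernel route: `Ḣ^{1/2} ⊂ L³` (BCD Thm. 1.38, in tree)
and Kato's small-`L³` theorem with its Clay bridge (`exists_clayA_of_small_L3`); `δ = δ_Kato/(C_emb + 1)`.
[cite: LemarieRieusset2016, Thm. 7.4 (B) (held PDF p. 151)] [cite: BahouriCheminDanchin2011, Thm. 1.38] -/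
theorem exists_clayA_of_small_homSobolevHalf :
    ∃ δ : ℝ, 0 < δ ∧ ∀ ν : ℝ, 0 < ν →
      ∀ u₀ : EuclideanSpace ℝ (Fin 3) → EuclideanSpace ℝ (Fin 3),
        ContDiff ℝ ∞ u₀ → NSWave0.IsDivFree u₀ → HasRapidSpatialDecay u₀ →
        Function.eHomSobolevSeminorm (1 / 2 : ℝ) (complexify ∘ u₀) ≤ ENNReal.ofReal (δ * ν) →
        ∃ (u : ℝ → EuclideanSpace ℝ (Fin 3) → EuclideanSpace ℝ (Fin 3))
          (p : ℝ → EuclideanSpace ℝ (Fin 3) → ℝ),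
          IsSmoothOnHalfSpace u ∧ IsSmoothOnHalfSpace p ∧ IsNavierStokesSolution ν 0 u₀ u p ∧
            HasBoundedEnergy u := by
  obtain ⟨δ₃, hδ₃, h3⟩ := exists_clayA_of_small_L3
  obtain ⟨C, hC⟩ := eLpNorm_three_le_eHomSobolevSeminorm_half_holds (F := EuclideanSpace ℂ (Fin 3))
  refine ⟨δ₃ / (C + 1), by positivity, fun ν hν u₀ hsm hdiv hdec hsmall => h3 ν hν u₀ hsm hdiv hdec ?_⟩
  have h2 := memLp_two_complexify_of_hasRapidSpatialDecay hsm hdec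
  -- `‖u₀‖_{L³} = ‖u₀^ℂ‖_{L³} ≤ C ‖u₀^ℂ‖_{Ḣ^{1/2}} ≤ C δ₃ν/(C+1) ≤ δ₃ ν`
  have hnorm : eLpNorm u₀ 3 volume = eLpNorm (complexify ∘ u₀) 3 volume :=
    eLpNorm_congr_norm_ae (Eventually.of_forall fun x => (norm_complexify (u₀ x)).symm)
  have hCle : (C : ℝ≥0∞) * ENNReal.ofReal (δ₃ / (C + 1) * ν) ≤ ENNReal.ofReal (δ₃ * ν) := by
    rw [← ENNReal.ofReal_coe_nnreal, ← ENNReal.ofReal_mul (NNReal.coe_nonneg C)]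
    refine ENNReal.ofReal_le_ofReal ?_
    have hC0 : (0 : ℝ) ≤ C := NNReal.coe_nonneg C
    rw [show (C : ℝ) * (δ₃ / (C + 1) * ν) = (C / (C + 1)) * (δ₃ * ν) by ring]
    exact mul_le_of_le_one_left (by positivity) ((div_le_one (by positivity)).2 (by linarith))
  calc eLpNorm u₀ 3 volume = eLpNorm (complexify ∘ u₀) 3 volume := hnorm
    _ ≤ C * Function.eHomSobolevSeminorm (1 / 2 : ℝ) (complexify ∘ u₀) := hC _ h2
    _ ≤ C * ENNReal.ofReal (δ₃ / (C + 1) * ν) := by gcongr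
    _ ≤ ENNReal.ofReal (δ₃ * ν) := hCle

end Literature.Barriers.NavierStokesRegularity
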